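import Mathlib
import Summits.RiemannHypothesis.RiemannHypothesis.Theorems.WeilFormatCSchurStep
import HarnessLib

/-!
# Format C: the structured-tail majorant (algebraic half of L-C3b)

Route context: Fourier–Galerkin / Schur-complement certificates of Weil positivity on a window ("format C";
cell memo `run/shared/lean/pub/rh-explicit/rh-explicit-weil-10/FORMATC-DESIGN.md` §4.6 / §8.2 / §8.4; supporting
stmt-RiemannHypothesis-0098).  Beyond the exactly computed columns `m ≤ M₃`, the coupling column `b_m = (W(n,m))_n` of the
window Gram is written as a few STRUCTURED directions plus a remainder,
`b_m(n) = Σ_d v_d(n)·φ_d(m) + r_m(n)`, `|r_m(n)| ≤ ρ_n·g_m` (`g_m = m^{−K−1}`), and the weighted tail Gram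
`Σ_{m>M₃} w_m b_m b_mᵀ` (`w_m = 1/d̂_m`) is majorised by `(1+θ)·V F Vᵀ + (1+θ⁻¹)·(Σ_m w_m g_m²)·n_B·diag(ρ²)`,
`F_{dd′} = Σ_m w_m φ_d(m) φ_{d′}(m)`.  THIS FILE proves that majorant as an inequality of real quadratic forms on
arbitrary finite index sets (rows `ι`, tail modes `T`, directions `Fin D`), using weil-3's Peter–Paul splitting
`WeilFormatC.sq_add_le_peterPaul` (`WeilFormatCSchurStep.lean`):

* `WeilFormatC.sq_sum_mul_le_card_mul` — `(Σ_n r_n x_n)² ≤ |ι|·Σ_n ρ_n² x_n²` when `|r_n| ≤ ρ_n`;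
* `WeilFormatC.tailMajorant` — **`Σ_{m∈T} w_m (Σ_n b_m(n) x_n)² ≤ (1+θ)·Σ_{d,d′} F_{dd′}(v_d·x)(v_{d′}·x)
  + (1+θ⁻¹)·(Σ_{m∈T} w_m g_m²)·|ι|·Σ_n ρ_n² x_n²`**.

With `WeilFormatC.sum_sq_div_le_of_split` / `schurStepDiag` (`WeilFormatCSchurStepDiag.lean`) this is how the hypothesis
`Σ_m c_m²/d_m ≤ xᵀUx` is met: `U = Σ_{m≤M₃} b_m b_mᵀ/d̂_m + U_tail`.  Elementary; standard axioms only.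
-/

-- `Summit.RiemannHypothesis.RiemannHypothesis.…` is the layout-mandated namespace (summit = problem name).
set_option linter.dupNamespace false

namespace Summit.RiemannHypothesis.RiemannHypothesis.Theorems.WeilFormatC

open Finset

/-- Cauchy–Schwarz for the remainder: if `|r n| ≤ ρ n` for all `n` then `(Σ_n r_n x_n)² ≤ |ι| · Σ_n ρ_n² x_n²`. -/
theorem sq_sum_mul_le_card_mul {ι : Type*} [Fintype ι] (r ρ x : ι → ℝ) (hr : ∀ n, |r n| ≤ ρ n) :
    (∑ n, r n * x n) ^ 2 ≤ Fintype.card ι * ∑ n, ρ n ^ 2 * x n ^ 2 := by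
  have h1 : |∑ n, r n * x n| ≤ ∑ n, ρ n * |x n| := by
    refine (Finset.abs_sum_le_sum_abs _ _).trans (Finset.sum_le_sum fun n _ ↦ ?_)
    rw [abs_mul]
    exact mul_le_mul_of_nonneg_right (hr n) (abs_nonneg _)
  have h2 : (∑ n, r n * x n) ^ 2 ≤ (∑ n, ρ n * |x n|) ^ 2 := by
    have h0 : 0 ≤ ∑ n, ρ n * |x n| := le_trans (abs_nonneg _) h1
    calc (∑ n, r n * x n) ^ 2 = |∑ n, r n * x n| ^ 2 := (sq_abs _).symm
      _ ≤ (∑ n, ρ n * |x n|) ^ 2 := pow_le_pow_left₀ (abs_nonneg _) h1 2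
  refine h2.trans ?_
  have hcs := Finset.sum_mul_sq_le_sq_mul_sq (Finset.univ : Finset ι) (fun _ ↦ (1 : ℝ)) (fun n ↦ ρ n * |x n|)
  simp only [one_mul, one_pow, Finset.sum_const, Finset.card_univ, nsmul_eq_mul, mul_one] at hcs
  refine hcs.trans (le_of_eq ?_)
  congr 1
  refine Finset.sum_congr rfl fun n _ ↦ ?_
  rw [mul_pow, sq_abs]

/-- The structured part summed over the tail: `Σ_m w_m (Σ_d a_d φ_d(m))² = Σ_d Σ_{d′} (Σ_m w_m φ_d(m) φ_{d′}(m)) a_d a_{d′}`. -/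
theorem sum_mul_sq_sum_eq {κ : Type*} {D : ℕ} (T : Finset κ) (w : κ → ℝ) (φ : Fin D → κ → ℝ) (a : Fin D → ℝ) :
    ∑ m ∈ T, w m * (∑ d, a d * φ d m) ^ 2
      = ∑ d, ∑ d', (∑ m ∈ T, w m * φ d m * φ d' m) * (a d * a d') := by
  have e : ∀ m ∈ T, w m * (∑ d, a d * φ d m) ^ 2 = ∑ d, ∑ d', w m * φ d m * φ d' m * (a d * a d') := by
    intro m _
    rw [sq, Finset.sum_mul_sum, Finset.mul_sum]
    refine Finset.sum_congr rfl fun d _ ↦ ?_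
    rw [Finset.mul_sum]
    refine Finset.sum_congr rfl fun d' _ ↦ by ring
  rw [Finset.sum_congr rfl e, Finset.sum_comm]
  refine Finset.sum_congr rfl fun d _ ↦ ?_
  rw [Finset.sum_comm]
  refine Finset.sum_congr rfl fun d' _ ↦ ?_
  rw [Finset.sum_mul]

/-- **The structured-tail majorant.**  Rows `ι` (finite), tail modes `T`, `D` structured directions.  If
`b m n = Σ_d v d n · φ d m + r m n` on `T`, `|r m n| ≤ ρ n · g m`, and `w m ≥ 0`, then for every `x` and every `θ > 0`:
`Σ_{m∈T} w_m (Σ_n b_m(n) x_n)² ≤ (1+θ) Σ_d Σ_{d′} F_{dd′} (v_d·x)(v_{d′}·x) + (1+θ⁻¹)(Σ_{m∈T} w_m g_m²)·|ι|·Σ_n ρ_n² x_n²`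
with `F_{dd′} = Σ_{m∈T} w_m φ_d(m) φ_{d′}(m)` and `v_d·x = Σ_n v_d(n) x_n`. -/
theorem tailMajorant {ι κ : Type*} [Fintype ι] {D : ℕ} (T : Finset κ) (b r : κ → ι → ℝ) (v : Fin D → ι → ℝ)
    (φ : Fin D → κ → ℝ) (w g : κ → ℝ) (ρ x : ι → ℝ) {θ : ℝ} (hθ : 0 < θ) (hw : ∀ m ∈ T, 0 ≤ w m)
    (hb : ∀ m ∈ T, ∀ n, b m n = (∑ d, v d n * φ d m) + r m n) (hr : ∀ m ∈ T, ∀ n, |r m n| ≤ ρ n * g m) :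
    ∑ m ∈ T, w m * (∑ n, b m n * x n) ^ 2
      ≤ (1 + θ) * ∑ d, ∑ d', (∑ m ∈ T, w m * φ d m * φ d' m) * ((∑ n, v d n * x n) * (∑ n, v d' n * x n))
        + (1 + θ⁻¹) * (∑ m ∈ T, w m * g m ^ 2) * (Fintype.card ι * ∑ n, ρ n ^ 2 * x n ^ 2) := by
  -- per mode: split the column sum into structured part z_m and remainder e_m
  set a : Fin D → ℝ := fun d ↦ ∑ n, v d n * x n with ha
  have hsplit : ∀ m ∈ T, ∑ n, b m n * x n = (∑ d, a d * φ d m) + ∑ n, r m n * x n := by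
    intro m hm
    have e1 : ∑ n, b m n * x n = ∑ n, ((∑ d, v d n * φ d m) * x n + r m n * x n) := by
      refine Finset.sum_congr rfl fun n _ ↦ ?_
      rw [hb m hm n]; ring
    rw [e1, Finset.sum_add_distrib]
    congr 1
    -- Σ_n (Σ_d v d n φ d m) x n = Σ_d (Σ_n v d n x n) φ d m
    simp only [ha, Finset.sum_mul]
    rw [Finset.sum_comm]
    refine Finset.sum_congr rfl fun d _ ↦ Finset.sum_congr rfl fun n _ ↦ by ring
  -- remainder bound per mode
  have hrem : ∀ m ∈ T, (∑ n, r m n * x n) ^ 2 ≤ g m ^ 2 * (Fintype.card ι * ∑ n, ρ n ^ 2 * x n ^ 2) := by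
    intro m hm
    have h := sq_sum_mul_le_card_mul (r m) (fun n ↦ ρ n * g m) x (hr m hm)
    refine h.trans (le_of_eq ?_)
    rw [Finset.mul_sum, Finset.mul_sum, Finset.mul_sum]
    refine Finset.sum_congr rfl fun n _ ↦ by ring
  -- termwise Peter–Paul, then sum
  have hterm : ∀ m ∈ T, w m * (∑ n, b m n * x n) ^ 2
      ≤ (1 + θ) * (w m * (∑ d, a d * φ d m) ^ 2)
        + (1 + θ⁻¹) * (w m * g m ^ 2) * (Fintype.card ι * ∑ n, ρ n ^ 2 * x n ^ 2) := by
    intro m hm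
    rw [hsplit m hm]
    have hpp := sq_add_le_peterPaul (p := ∑ d, a d * φ d m) (q := ∑ n, r m n * x n) hθ
    have hwm := hw m hm
    have hθ1 : 0 ≤ 1 + θ⁻¹ := by positivity
    have h2 := mul_le_mul_of_nonneg_left (hrem m hm) (mul_nonneg hθ1 hwm)
    nlinarith [mul_le_mul_of_nonneg_left hpp hwm, h2]
  refine (Finset.sum_le_sum hterm).trans (le_of_eq ?_)
  rw [Finset.sum_add_distrib, ← Finset.mul_sum, ← Finset.sum_mul, ← Finset.mul_sum,
    sum_mul_sq_sum_eq T w φ a]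

end Summit.RiemannHypothesis.RiemannHypothesis.Theorems.WeilFormatC
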